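import Literature.Geometry.ComplexAnalytic.PhamBrieskornCyclicNodeFixedPointCharts
import HarnessLib

/-!
# The local piece `F°∕ι` in HOMOLOGY, and its transport along a conjugating homeomorphism (the form consumed by the two-ball localisation)

Family `hodge`, layer `Literature/Geometry/ComplexAnalytic`; sequel of `PhamBrieskornCyclicNodeFixedPointCharts` (`quotientPiece_package_holds`: on
`H²(F°∕ι; ℚ)`, rank `2`, `(τ̄^*)² = −1`, descended model monodromy `= τ̄^*`). The two-ball localisation
(`Literature.AlgebraicTopology.SingularHomology.HomologySelfMapTwoLocalPieces`) and the recognition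
(`Summit…Theorems.Q8BireflectionRecognitionHomological`) consume the local piece in HOMOLOGY and on an open piece `A` of the member
that is only HOMEOMORPHIC to `F°∕ι` (the homeomorphism conjugating the geometric monodromy to the descended model monodromy and the deck
transformation to `τ̄`). Written by the prover seat `hodge-nonav-prover-Ax` (g18), crux K1Q `VeryGeneralQuaternionCommutatorsInHg`
(route `Summits/HodgeConjecture/HodgeConjecture/Theses/Q8SymplecticPowers.lean`, stub S5).

* §1 Kronecker duality tools over a field: a self-map identity `g^* = g'^*` on `Hⁿ(X; F)` gives `g_* = g'_*` on `Hₙ(X; F)`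
  (`map_eq_map_of_cohomologyMap_eq`, and the composite form); `finrank Hₙ = finrank Hⁿ`.
* §2 **`quotientPiece_package_homology`**: on `H₂(F°∕ι; ℚ)` (`p = 4`): `dim = 2`, `τ̄_*(τ̄_* z) = −z`, `h̄_* = τ̄_*`.
* §3 **`localPiece_of_conj`**: for ANY space `A` with self-maps `g` (monodromy) and `s` (deck) and a homeomorphism `e : A ≃ₜ F°∕ι` with
  `e ∘ g = h̄ ∘ e`, `e ∘ s = τ̄ ∘ e`: `dim_ℚ H₂(A; ℚ) = 2`, `s_*(s_* z) = −z`, `g_* = s_*` on `H₂(A; ℚ)`.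

No HC content; no named fact; rung F-H1 not moved.

## References

* [HatcherAT2002] A. Hatcher, Algebraic Topology, CUP 2002, §3.1 Thm. 3.2 (p. 195), p. 198, p. 201; §3.G Prop. 3G.1.
* [Milnor1968] J. Milnor, Singular Points of Complex Hypersurfaces, §9 Thm. 9.1 and p. 77.
* [CarlsonToledo1999] J. A. Carlson, D. Toledo, Duke Math. J. 97 (1999), §6 (held text p0013–p0014).
-/

noncomputable section

open Complex ContinuousMap Set CategoryTheory
open Literature.AlgebraicTopology.SingularHomology

namespace Literature.Geometry.ComplexAnalytic

namespace PhamBrieskorn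

/-! ### §1 Kronecker duality tools -/

section Kronecker

variable (F : Type) [Field F] {X : Type} [TopologicalSpace X]

/-- Over a field, homology classes are separated by cohomology classes: if `⟨a, z⟩ = 0` for all `a` then `z = 0`.
[cite: HatcherAT2002, §3.1 Thm. 3.2 (p. 195) and p. 198] -/
theorem eq_zero_of_forall_kroneckerPairing_eq_zero (n : ℕ) (z : singularHomology F F X n)
    (h : ∀ a : singularCohomology F F X n, kroneckerPairing F F X n a z = 0) : z = 0 := by
  refine (Module.forall_dual_apply_eq_zero_iff F z).1 fun φ => ?_
  obtain ⟨a, rfl⟩ := (kroneckerPairing_bijective_of_field F X n).2 φ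
  exact h a

/-- **`g^* = g'^*` on `Hⁿ(X; F)` implies `g_* = g'_*` on `Hₙ(X; F)`** (composites allowed: `(g₂ ∘ g₁)` against `(g₂' ∘ g₁')`), by Kronecker
naturality and separation. [cite: HatcherAT2002, §3.1 p. 201] -/
theorem map_map_eq_map_map_of_cohomology (n : ℕ) (g₁ g₂ g₁' g₂' : C(X, X))
    (h : ∀ a : singularCohomology F F X n, singularCohomology.map F F g₁ n (singularCohomology.map F F g₂ n a) =
      singularCohomology.map F F g₁' n (singularCohomology.map F F g₂' n a))
    (z : singularHomology F F X n) :
    singularHomology.map F F g₂ n (singularHomology.map F F g₁ n z) = singularHomology.map F F g₂' n (singularHomology.map F F g₁' n z) := by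
  rw [← sub_eq_zero]
  refine eq_zero_of_forall_kroneckerPairing_eq_zero F n _ fun a => ?_
  rw [map_sub, ← kroneckerPairing_map, ← kroneckerPairing_map, ← kroneckerPairing_map, ← kroneckerPairing_map, h a, sub_self]

/-- `dim_F Hₙ(X; F) = dim_F Hⁿ(X; F)`. [cite: HatcherAT2002, §3.1 Thm. 3.2 and Cor. 3.3] -/
theorem finrank_singularHomology_eq_finrank_singularCohomology (n : ℕ) :
    Module.finrank F (singularHomology F F X n) = Module.finrank F (singularCohomology F F X n) :=
  (finrank_singularCohomology_eq_bettiNumber_of_field F X n).symm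

end Kronecker

/-! ### §2 The local piece in homology -/

section Homology

variable {ζ : ℂ} (hζ : IsPrimitiveRoot ζ 4)

attribute [local instance] OrbitSpace.homeoMulAction

/-- **The local piece `F°∕ι` in homology (`p = 4`)**: `dim_ℚ H₂(F°∕ι; ℚ) = 2`, `τ̄_*(τ̄_* z) = −z`, and the descended model monodromy acts
as `τ̄_*` on `H₂(F°∕ι; ℚ)` (Kronecker duals of `quotientPiece_package_holds`). [cite: Milnor1968, §9 Thm. 9.1 and p. 77]
[cite: CarlsonToledo1999, §6 (kdoublept) (held text p0013–p0014)] [cite: HatcherAT2002, §3.1 p. 201] -/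
theorem quotientPiece_package_homology :
    Module.finrank ℚ (singularHomology ℚ ℚ (OrbitSpace (iotaPunct 4 four_ne_zero (by decide))) 2) = 2 ∧
    (∀ z : singularHomology ℚ ℚ (OrbitSpace (iotaPunct 4 four_ne_zero (by decide))) 2,
      singularHomology.map ℚ ℚ
          (OrbitSpace.map (rotatePunct 4 four_ne_zero ⟨ζ, hζ.pow_eq_one⟩)
            (commute_rotatePunct_iotaPunct 4 four_ne_zero (by decide) ⟨ζ, hζ.pow_eq_one⟩) :
            C(OrbitSpace (iotaPunct 4 four_ne_zero (by decide)), OrbitSpace (iotaPunct 4 four_ne_zero (by decide)))) 2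
        (singularHomology.map ℚ ℚ
          (OrbitSpace.map (rotatePunct 4 four_ne_zero ⟨ζ, hζ.pow_eq_one⟩)
            (commute_rotatePunct_iotaPunct 4 four_ne_zero (by decide) ⟨ζ, hζ.pow_eq_one⟩) :
            C(OrbitSpace (iotaPunct 4 four_ne_zero (by decide)), OrbitSpace (iotaPunct 4 four_ne_zero (by decide)))) 2 z) = -z) ∧
    (∀ z : singularHomology ℚ ℚ (OrbitSpace (iotaPunct 4 four_ne_zero (by decide))) 2,
      singularHomology.map ℚ ℚ
          (OrbitSpace.map (negPairPunct 4 * rotatePunct 4 four_ne_zero ⟨ζ, hζ.pow_eq_one⟩)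
            (commute_modelPunct_iotaPunct 4 four_ne_zero (by decide) ⟨ζ, hζ.pow_eq_one⟩) :
            C(OrbitSpace (iotaPunct 4 four_ne_zero (by decide)), OrbitSpace (iotaPunct 4 four_ne_zero (by decide)))) 2 z =
      singularHomology.map ℚ ℚ
          (OrbitSpace.map (rotatePunct 4 four_ne_zero ⟨ζ, hζ.pow_eq_one⟩)
            (commute_rotatePunct_iotaPunct 4 four_ne_zero (by decide) ⟨ζ, hζ.pow_eq_one⟩) :
            C(OrbitSpace (iotaPunct 4 four_ne_zero (by decide)), OrbitSpace (iotaPunct 4 four_ne_zero (by decide)))) 2 z) := by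
  obtain ⟨hdim, hsq, hmod⟩ := quotientPiece_package_holds hζ
  set τb : C(OrbitSpace (iotaPunct 4 four_ne_zero (by decide)), OrbitSpace (iotaPunct 4 four_ne_zero (by decide))) :=
    ((OrbitSpace.map (rotatePunct 4 four_ne_zero ⟨ζ, hζ.pow_eq_one⟩)
      (commute_rotatePunct_iotaPunct 4 four_ne_zero (by decide) ⟨ζ, hζ.pow_eq_one⟩) :
        OrbitSpace (iotaPunct 4 four_ne_zero (by decide)) ≃ₜ OrbitSpace (iotaPunct 4 four_ne_zero (by decide))) :
      C(OrbitSpace (iotaPunct 4 four_ne_zero (by decide)), OrbitSpace (iotaPunct 4 four_ne_zero (by decide)))) with hτb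
  set hb : C(OrbitSpace (iotaPunct 4 four_ne_zero (by decide)), OrbitSpace (iotaPunct 4 four_ne_zero (by decide))) :=
    ((OrbitSpace.map (negPairPunct 4 * rotatePunct 4 four_ne_zero ⟨ζ, hζ.pow_eq_one⟩)
      (commute_modelPunct_iotaPunct 4 four_ne_zero (by decide) ⟨ζ, hζ.pow_eq_one⟩) :
        OrbitSpace (iotaPunct 4 four_ne_zero (by decide)) ≃ₜ OrbitSpace (iotaPunct 4 four_ne_zero (by decide))) :
      C(OrbitSpace (iotaPunct 4 four_ne_zero (by decide)), OrbitSpace (iotaPunct 4 four_ne_zero (by decide)))) with hhb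
  refine ⟨?_, fun z => ?_, fun z => ?_⟩
  · rw [finrank_singularHomology_eq_finrank_singularCohomology]; exact hdim
  · -- `τ̄_* τ̄_* = −id`: test against cohomology classes
    rw [eq_neg_iff_add_eq_zero]
    refine eq_zero_of_forall_kroneckerPairing_eq_zero ℚ 2 _ fun a => ?_
    rw [map_add, ← kroneckerPairing_map, ← kroneckerPairing_map, hsq a, map_neg, LinearMap.neg_apply, neg_add_cancel]
  · -- `h̄_* = τ̄_*`: test against cohomology classes
    rw [← sub_eq_zero]
    refine eq_zero_of_forall_kroneckerPairing_eq_zero ℚ 2 _ fun a => ?_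
    rw [map_sub, ← kroneckerPairing_map, ← kroneckerPairing_map, hmod a, sub_self]

end Homology

/-! ### §3 Transport to a homeomorphic local piece -/

section Conj

variable (F : Type) [Field F] {A Q : Type} [TopologicalSpace A] [TopologicalSpace Q]

/-- Conjugate self-maps have conjugate actions on homology: `e ∘ g = ḡ ∘ e` gives `e_* (g_* z) = ḡ_* (e_* z)`. [cite: HatcherAT2002, §2.1] -/
theorem map_map_of_conj (e : A ≃ₜ Q) (g : C(A, A)) (gb : C(Q, Q)) (hconj : (e : C(A, Q)).comp g = gb.comp (e : C(A, Q))) (n : ℕ)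
    (z : singularHomology F F A n) :
    singularHomology.map F F (e : C(A, Q)) n (singularHomology.map F F g n z) = singularHomology.map F F gb n (singularHomology.map F F (e : C(A, Q)) n z) := by
  rw [← ModuleCat.comp_apply, ← singularHomology.map_comp, hconj, singularHomology.map_comp, ModuleCat.comp_apply]

/-- **Transport of the local-piece package along a conjugating homeomorphism.** If `e : A ≃ₜ Q` conjugates `g` to `ḡ` and `s` to `s̄`, and on
`Hₙ(Q; F)`: `s̄_* s̄_* = −1`, `ḡ_* = s̄_*`, then the same holds for `g, s` on `Hₙ(A; F)`, and `dim Hₙ(A; F) = dim Hₙ(Q; F)`.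
[cite: HatcherAT2002, §2.1] -/
theorem localPiece_of_conj (e : A ≃ₜ Q) (g s : C(A, A)) (gb sb : C(Q, Q)) (hg : (e : C(A, Q)).comp g = gb.comp (e : C(A, Q)))
    (hs : (e : C(A, Q)).comp s = sb.comp (e : C(A, Q))) (n : ℕ)
    (hsq : ∀ w : singularHomology F F Q n, singularHomology.map F F sb n (singularHomology.map F F sb n w) = -w)
    (hmod : ∀ w : singularHomology F F Q n, singularHomology.map F F gb n w = singularHomology.map F F sb n w) :
    Module.finrank F (singularHomology F F A n) = Module.finrank F (singularHomology F F Q n) ∧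
    (∀ z : singularHomology F F A n, singularHomology.map F F s n (singularHomology.map F F s n z) = -z) ∧
    (∀ z : singularHomology F F A n, singularHomology.map F F g n z = singularHomology.map F F s n z) := by
  have hinj : Function.Injective (singularHomology.map F F (e : C(A, Q)) n) :=
    ((forget (ModuleCat F)).mapIso (singularHomology.mapIso F F e n)).toEquiv.injective
  refine ⟨(singularHomology.mapIso F F e n).toLinearEquiv.finrank_eq, fun z => hinj ?_, fun z => hinj ?_⟩
  · rw [map_map_of_conj F e s sb hs, map_map_of_conj F e s sb hs, hsq, map_neg]
  · rw [map_map_of_conj F e g gb hg, map_map_of_conj F e s sb hs, hmod]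

variable {ζ : ℂ} (hζ : IsPrimitiveRoot ζ 4)

attribute [local instance] OrbitSpace.homeoMulAction

/-- **The local piece transported to a homeomorphic open piece of the member** (`p = 4`): for a space `A` (a ball piece of `X_s ∖ ⋃E`) with
self-maps `g` (the geometric monodromy) and `s` (the deck rotation) and a homeomorphism `e : A ≃ₜ F°∕ι` with `e ∘ g = h̄ ∘ e`,
`e ∘ s = τ̄ ∘ e`: `dim_ℚ H₂(A; ℚ) = 2`, `s_* s_* = −1`, `g_* = s_*` on `H₂(A; ℚ)` — the local input of the two-ball localisation ∕
`exists_bireflection_datum_of_homological_datum`. [cite: CarlsonToledo1999, §6 (kdoublept) (held text p0013–p0014)] [cite: Milnor1968, §9 Thm. 9.1 and p. 77] -/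
theorem localPiece_package_of_conj (e : A ≃ₜ OrbitSpace (iotaPunct 4 four_ne_zero (by decide)))
    (g s : C(A, A))
    (hg : (e : C(A, OrbitSpace (iotaPunct 4 four_ne_zero (by decide)))).comp g =
      ((OrbitSpace.map (negPairPunct 4 * rotatePunct 4 four_ne_zero ⟨ζ, hζ.pow_eq_one⟩)
        (commute_modelPunct_iotaPunct 4 four_ne_zero (by decide) ⟨ζ, hζ.pow_eq_one⟩) :
          C(OrbitSpace (iotaPunct 4 four_ne_zero (by decide)), OrbitSpace (iotaPunct 4 four_ne_zero (by decide)))).comp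
        (e : C(A, OrbitSpace (iotaPunct 4 four_ne_zero (by decide))))))
    (hs : (e : C(A, OrbitSpace (iotaPunct 4 four_ne_zero (by decide)))).comp s =
      ((OrbitSpace.map (rotatePunct 4 four_ne_zero ⟨ζ, hζ.pow_eq_one⟩)
        (commute_rotatePunct_iotaPunct 4 four_ne_zero (by decide) ⟨ζ, hζ.pow_eq_one⟩) :
          C(OrbitSpace (iotaPunct 4 four_ne_zero (by decide)), OrbitSpace (iotaPunct 4 four_ne_zero (by decide)))).comp
        (e : C(A, OrbitSpace (iotaPunct 4 four_ne_zero (by decide)))))) :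
    Module.finrank ℚ (singularHomology ℚ ℚ A 2) = 2 ∧
    (∀ z : singularHomology ℚ ℚ A 2, singularHomology.map ℚ ℚ s 2 (singularHomology.map ℚ ℚ s 2 z) = -z) ∧
    (∀ z : singularHomology ℚ ℚ A 2, singularHomology.map ℚ ℚ g 2 z = singularHomology.map ℚ ℚ s 2 z) := by
  obtain ⟨hdim, hsq, hmod⟩ := quotientPiece_package_homology hζ
  obtain ⟨h1, h2, h3⟩ := localPiece_of_conj ℚ e g s _ _ hg hs 2 hsq hmod
  exact ⟨h1.trans hdim, h2, h3⟩

end Conj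

end PhamBrieskorn

end Literature.Geometry.ComplexAnalytic

end
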